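/-
Copyright (c) 2026. All rights reserved.
Released under Apache 2.0 license as described in the file LICENSE.
Authors: abc-iut cell, prover seat abc-iut-E-t32 (gen 11).
-/
import Literature.NumberTheory.NumberFields.MinkowskiRootDiscriminantThresholds
import HarnessLib

/-!
# Minkowski's discriminant bound in degrees `4` and `6`: `|d_K| ≥ 44`, `|d_K| ≥ 981`, and the signature refinements

Classical geometry of numbers; proof-only complement (abc-iut cell, R-J rows R-23 / R-32, seat abc-iut-E-t32) of abc-iut-f-072's
`MinkowskiRootDiscriminantThresholds.lean` (`pow_mul_pi_pow_le_abs_discr_mul`: `n^{2n}·π^a ≤ |d_K|·4^a·(n!)²` for `a ≥ 2r₂`, from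
Mathlib's exact Minkowski bound `NumberField.abs_discr_ge'`).  In the two EVEN degrees `4`, `6` where the bound does NOT beat the root
discriminant `2√3` (`12^{⌊n/2⌋}`), it still pins the discriminant from below:

* `fortyfour_le_abs_discr_of_finrank_eq_four` — `[K:ℚ] = 4 ⇒ 44 ≤ |d_K|` (`4⁸π⁴/(4⁴·24²) = 43.29…`);
* `seventyone_le_abs_discr_of_finrank_eq_four_of_nrComplexPlaces_le_one` — `[K:ℚ] = 4`, `r₂ ≤ 1 ⇒ 71 ≤ |d_K|` (`70.17…`), so a quartic
  field with `|d_K| ≤ 70` is totally complex;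
* `lt_abs_discr_of_finrank_eq_six` — `[K:ℚ] = 6 ⇒ 980 < |d_K|` (`6¹²π⁶/(4⁶·720²) = 985.6…`);
* `lt_abs_discr_of_finrank_eq_six_of_nrComplexPlaces_le_one` — `[K:ℚ] = 6`, `r₂ ≤ 1 ⇒ 2360 < |d_K|` (`2589.9…`);
* `nrComplexPlaces_eq_two_of_finrank_eq_four_of_abs_discr_le` / `two_le_nrComplexPlaces_of_finrank_eq_six_of_abs_discr_le` — the
  signature consequences (`|d| ≤ 70 ⇒ r₂ = 2` in degree `4`; `|d| ≤ 2360 ⇒ r₂ ≥ 2` in degree `6`).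

Consumer: the abc-iut cell's Y-26 residual cells (pinned quartic fields have `|d_F| ∈ {48, 144}`, pinned sextic fields `|d_F| = 1728`).
Nothing here is specific to that consumer. [cite: EsmondeMurty1999, Ex. 6.5.12 and Ex. 6.5.21 p. 93] [cite: NeukirchANT1999, Ch. III (2.14)]
-/

namespace Literature.NumberTheory.NumberFields

open NumberField NumberField.InfinitePlace Module Real

variable (K : Type*) [Field K] [NumberField K]

/-- `π⁴ > 97.21` and `π⁶ > 958.4` from `π > 3.14`. [folklore] -/
private theorem pi_pow_four_gt : (97.21 : ℝ) < π ^ 4 := by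
  have h := pow_lt_pow_left₀ Real.pi_gt_d2 (by norm_num) (by norm_num : (4 : ℕ) ≠ 0)
  exact lt_of_le_of_lt (by norm_num) h

/-- `π⁶ > 958.4`. [folklore] -/
private theorem pi_pow_six_gt : (958.4 : ℝ) < π ^ 6 := by
  have h := pow_lt_pow_left₀ Real.pi_gt_d2 (by norm_num) (by norm_num : (6 : ℕ) ≠ 0)
  exact lt_of_le_of_lt (by norm_num) h

/-- `π² > 9.8596`. [folklore] -/
private theorem pi_sq_gt : (9.8596 : ℝ) < π ^ 2 := by
  have h := pow_lt_pow_left₀ Real.pi_gt_d2 (by norm_num) (by norm_num : (2 : ℕ) ≠ 0)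
  exact lt_of_le_of_lt (by norm_num) h

/-- **`[K:ℚ] = 4 ⇒ 44 ≤ |d_K|`** (Minkowski, `r₂ ≤ 2`). [cite: NeukirchANT1999, Ch. III (2.14)] -/
theorem fortyfour_le_abs_discr_of_finrank_eq_four (h4 : finrank ℚ K = 4) : (44 : ℤ) ≤ |discr K| := by
  have hsig := NumberField.InfinitePlace.card_add_two_mul_card_eq_rank K
  have ha : 2 * nrComplexPlaces K ≤ 4 := by omega
  have hM := pow_mul_pi_pow_le_abs_discr_mul K ha
  rw [h4] at hM
  have h : (43 : ℝ) < |((discr K : ℤ) : ℝ)| := by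
    norm_num [Nat.factorial] at hM
    nlinarith [abs_nonneg (((discr K : ℤ) : ℝ)), pi_pow_four_gt]
  rw [← Int.cast_abs] at h
  have h' : (43 : ℤ) < |discr K| := by exact_mod_cast h
  omega

/-- **`[K:ℚ] = 4`, `r₂ ≤ 1 ⇒ 71 ≤ |d_K|`**: a quartic field with `|d_K| ≤ 70` is totally complex. [cite: NeukirchANT1999, Ch. III (2.14)] -/
theorem seventyone_le_abs_discr_of_finrank_eq_four_of_nrComplexPlaces_le_one (h4 : finrank ℚ K = 4)
    (hr : nrComplexPlaces K ≤ 1) : (71 : ℤ) ≤ |discr K| := by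
  have ha : 2 * nrComplexPlaces K ≤ 2 := by omega
  have hM := pow_mul_pi_pow_le_abs_discr_mul K ha
  rw [h4] at hM
  have h : (70 : ℝ) < |((discr K : ℤ) : ℝ)| := by
    norm_num [Nat.factorial] at hM
    nlinarith [abs_nonneg (((discr K : ℤ) : ℝ)), pi_sq_gt]
  rw [← Int.cast_abs] at h
  have h' : (70 : ℤ) < |discr K| := by exact_mod_cast h
  omega

/-- **`[K:ℚ] = 6 ⇒ 980 < |d_K|`** (Minkowski, `r₂ ≤ 3`). [cite: NeukirchANT1999, Ch. III (2.14)] -/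
theorem lt_abs_discr_of_finrank_eq_six (h6 : finrank ℚ K = 6) : (980 : ℤ) < |discr K| := by
  have hsig := NumberField.InfinitePlace.card_add_two_mul_card_eq_rank K
  have ha : 2 * nrComplexPlaces K ≤ 6 := by omega
  have hM := pow_mul_pi_pow_le_abs_discr_mul K ha
  rw [h6] at hM
  have h : (980 : ℝ) < |((discr K : ℤ) : ℝ)| := by
    norm_num [Nat.factorial] at hM
    nlinarith [abs_nonneg (((discr K : ℤ) : ℝ)), pi_pow_six_gt]
  rw [← Int.cast_abs] at h
  exact_mod_cast h

/-- **`[K:ℚ] = 6`, `r₂ ≤ 1 ⇒ 2360 < |d_K|`.** [cite: NeukirchANT1999, Ch. III (2.14)] -/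
theorem lt_abs_discr_of_finrank_eq_six_of_nrComplexPlaces_le_one (h6 : finrank ℚ K = 6) (hr : nrComplexPlaces K ≤ 1) :
    (2360 : ℤ) < |discr K| := by
  have ha : 2 * nrComplexPlaces K ≤ 2 := by omega
  have hM := pow_mul_pi_pow_le_abs_discr_mul K ha
  rw [h6] at hM
  have h : (2360 : ℝ) < |((discr K : ℤ) : ℝ)| := by
    norm_num [Nat.factorial] at hM
    nlinarith [abs_nonneg (((discr K : ℤ) : ℝ)), pi_sq_gt]
  rw [← Int.cast_abs] at h
  exact_mod_cast h

/-- A quartic field with `|d_K| ≤ 70` is totally complex (`r₂ = 2`). [cite: NeukirchANT1999, Ch. III (2.14)] -/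
theorem nrComplexPlaces_eq_two_of_finrank_eq_four_of_abs_discr_le (h4 : finrank ℚ K = 4) (hd : |discr K| ≤ 70) :
    nrComplexPlaces K = 2 := by
  have hsig := NumberField.InfinitePlace.card_add_two_mul_card_eq_rank K
  rw [h4] at hsig
  by_contra hne
  have h71 := seventyone_le_abs_discr_of_finrank_eq_four_of_nrComplexPlaces_le_one K h4 (by omega)
  omega

/-- A sextic field with `|d_K| ≤ 2360` has at least two complex places. [cite: NeukirchANT1999, Ch. III (2.14)] -/
theorem two_le_nrComplexPlaces_of_finrank_eq_six_of_abs_discr_le (h6 : finrank ℚ K = 6) (hd : |discr K| ≤ 2360) :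
    2 ≤ nrComplexPlaces K := by
  by_contra hlt
  have h := lt_abs_discr_of_finrank_eq_six_of_nrComplexPlaces_le_one K h6 (by omega)
  omega

end Literature.NumberTheory.NumberFields
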